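import Literature.Topology.FourManifolds.MorseAffine
import Literature.Topology.FourManifolds.MorseTurnAbout
import Literature.Topology.FourManifolds.SPC4HandleChainProofs
import Literature.Topology.FourManifolds.CobordismMorseFunctions
import HarnessLib

/-!
# Seam gluing of Morse functions, III: local Morse data of the reparametrised pieces

Helper file (lead c1, crux `ConvexBisection.AcyclicBisectionRigidity`, item
stmt-SmoothPoincare4-10507).  The glued Morse function of `M ∪_φ N` restricts to the pieces as
`1 - B (1 - f_M)` and `1 + A (1 - f_N)` for increasing reparametrisations `A`, `B` which are LINEAR
near the critical points; on the seam piece `∂M × ℝ` it is a function `σ (t)` of the collar height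
alone.  This file records the pointwise Morse bookkeeping of such functions (Milnor 1963, §2;
Milnor 1965, Thm. 4.1 and proof of Thm. 9.1):

* `not_isMCriticalPt_comp_snd` — `(x, t) ↦ σ t` has no critical point on `X × ℝ` if `σ' ≠ 0`;
* `isMCriticalPt_oneSubReparam_iff`, `isMCriticalPt_oneAddReparam_iff` — `1 - B (1 - f)` and
  `1 + A (1 - f)` have the critical points of `f` (`A', B' > 0`);
* `morseData_of_eventuallyEq_pos_affine` — a function equal near a critical point `x` of a Morse `f`
  to `c · f + c'` (`c > 0`) is critical and nondegenerate at `x` with the index of `f`;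
* `morseData_of_eventuallyEq_const_sub_affine` — one equal near `x` to `c' - c · f` (`c > 0`) is
  critical and nondegenerate at `x` with the complementary index `dim - index_x f`.

Everything is proved; no definitions. [folklore]
-/

noncomputable section

open scoped Manifold ContDiff Topology
open Set Function Filter Literature.Topology.FourManifolds

-- the prescribed namespace `Summit.<P>.<Sub>.…` duplicates `SmoothPoincare4` (P = Sub)
set_option linter.dupNamespace false

namespace Summit.SmoothPoincare4.SmoothPoincare4.Theorems.AcyclicBisectionRigidity.SeamGluing

/-! ### A function of the height alone has no critical points -/

section NoCrit

variable {EX HX : Type*} [NormedAddCommGroup EX] [NormedSpace ℝ EX] [TopologicalSpace HX]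
  {IX : ModelWithCorners ℝ EX HX} {X : Type*} [TopologicalSpace X] [ChartedSpace HX X]

/-- **`(x, t) ↦ σ t` has no critical points on `X × ℝ` when `σ' ≠ 0` everywhere**: along the
vertical curve `s ↦ (x, s)` the function is `σ`, whose derivative does not vanish (chain rule;
compare `TraceMorseFunction.not_isMCriticalPt_cylHeight`). [cite: Milnor1963, §2] -/
theorem not_isMCriticalPt_comp_snd {σ : ℝ → ℝ} (hσs : ContDiff ℝ ∞ σ)
    (hσd : ∀ t, ∃ d, d ≠ 0 ∧ HasDerivAt σ d t) (p : X × ℝ) :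
    ¬ IsMCriticalPt (IX.prod 𝓘(ℝ, ℝ)) (fun q : X × ℝ => σ q.2) p := by
  intro hc
  have hS : ContMDiff (IX.prod 𝓘(ℝ, ℝ)) 𝓘(ℝ, ℝ) ∞ (fun q : X × ℝ => σ q.2) :=
    hσs.contMDiff.comp contMDiff_snd
  set γ : ℝ → X × ℝ := fun s => (p.1, s) with hγ
  have hγs : ContMDiff 𝓘(ℝ, ℝ) (IX.prod 𝓘(ℝ, ℝ)) ∞ γ := contMDiff_const.prodMk contMDiff_id
  have hγp : γ p.2 = p := Prod.ext rfl rfl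
  have hcomp : mfderiv 𝓘(ℝ, ℝ) 𝓘(ℝ, ℝ) ((fun q : X × ℝ => σ q.2) ∘ γ) p.2 = 0 := by
    rw [mfderiv_comp p.2 (by rw [hγp]; exact hS.mdifferentiableAt (by simp))
      (hγs.mdifferentiableAt (by simp)), hγp]
    rw [IsMCriticalPt] at hc
    rw [hc]
    exact ContinuousLinearMap.zero_comp _
  obtain ⟨d, hd, hσ'⟩ := hσd p.2
  rw [mfderiv_eq_fderiv, show ((fun q : X × ℝ => σ q.2) ∘ γ) = σ from rfl] at hcomp
  erw [hσ'.hasFDerivAt.fderiv] at hcomp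
  have h1 : d = 0 := by
    have := DFunLike.congr_fun hcomp (1 : ℝ)
    change (1 : ℝ) • d = (0 : ℝ) at this
    rwa [one_smul] at this
  exact hd h1

end NoCrit

/-! ### Reparametrised functions: critical points -/

section Reparam

variable {E H : Type*} [NormedAddCommGroup E] [NormedSpace ℝ E] [TopologicalSpace H]
  {I : ModelWithCorners ℝ E H} {M : Type*} [TopologicalSpace M] [ChartedSpace H M]

/-- **`1 - B (1 - f)` has exactly the critical points of `f`** when `B' > 0` (post-composition
with a real function of nonvanishing derivative). [cite: Milnor1963, §2] -/
theorem isMCriticalPt_oneSubReparam_iff {f : M → ℝ} {B : ℝ → ℝ}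
    (hBd : ∀ u, ∃ d, 0 < d ∧ HasDerivAt B d u) {x : M} (hf : MDifferentiableAt I 𝓘(ℝ, ℝ) f x) :
    IsMCriticalPt I (fun y => 1 - B (1 - f y)) x ↔ IsMCriticalPt I f x := by
  obtain ⟨d, hd0, hd⟩ := hBd (1 - f x)
  have hτ : HasDerivAt (fun u : ℝ => 1 - B (1 - u)) (0 - d * (0 - 1)) (f x) :=
    (hasDerivAt_const _ (1 : ℝ)).sub (hd.comp _ ((hasDerivAt_const _ (1 : ℝ)).sub (hasDerivAt_id _)))
  have hne : (0 - d * (0 - 1) : ℝ) ≠ 0 := by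
    have : (0 - d * (0 - 1) : ℝ) = d := by ring
    rw [this]; exact hd0.ne'
  exact isMCriticalPt_comp_iff_of_hasDerivAt (σ := fun u : ℝ => 1 - B (1 - u)) hτ hne hf

/-- **`1 + A (1 - f)` has exactly the critical points of `f`** when `A' > 0`. [cite: Milnor1963, §2] -/
theorem isMCriticalPt_oneAddReparam_iff {f : M → ℝ} {A : ℝ → ℝ}
    (hAd : ∀ u, ∃ d, 0 < d ∧ HasDerivAt A d u) {x : M} (hf : MDifferentiableAt I 𝓘(ℝ, ℝ) f x) :
    IsMCriticalPt I (fun y => 1 + A (1 - f y)) x ↔ IsMCriticalPt I f x := by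
  obtain ⟨d, hd0, hd⟩ := hAd (1 - f x)
  have hτ : HasDerivAt (fun u : ℝ => 1 + A (1 - u)) (0 + d * (0 - 1)) (f x) :=
    (hasDerivAt_const _ (1 : ℝ)).add (hd.comp _ ((hasDerivAt_const _ (1 : ℝ)).sub (hasDerivAt_id _)))
  have hne : (0 + d * (0 - 1) : ℝ) ≠ 0 := by
    have : (0 + d * (0 - 1) : ℝ) = -d := by ring
    rw [this]; exact neg_ne_zero.2 hd0.ne'
  exact isMCriticalPt_comp_iff_of_hasDerivAt (σ := fun u : ℝ => 1 + A (1 - u)) hτ hne hf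

end Reparam

/-! ### Local affine normal forms: nondegeneracy and index -/

section LocalAffine

variable {E H : Type*} [NormedAddCommGroup E] [NormedSpace ℝ E] [FiniteDimensional ℝ E]
  [TopologicalSpace H] {I : ModelWithCorners ℝ E H}
  {M : Type*} [TopologicalSpace M] [ChartedSpace H M] [IsManifold I ∞ M]

omit [IsManifold I ∞ M] in
/-- **A function which near a critical point `x` of the Morse function `f` equals `c · f + c'`
with `c > 0`** is critical at `x`, has nondegenerate Hessian there, and the SAME Morse index as
`f` (Milnor 1965, Thm. 4.1 (c) / Thm. 4.8, renormalisation; the Hessian only sees the germ). [cite: MilnorHCobordism1965, Thm. 4.8 (alternate version; renormalisation)] -/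
theorem morseData_of_eventuallyEq_pos_affine {f g : M → ℝ} (hf : IsMorse I f) {x : M} {c c' : ℝ}
    (hc : 0 < c) (h : g =ᶠ[𝓝 x] fun y => c * f y + c') (hx : IsMCriticalPt I f x) :
    IsMCriticalPt I g x ∧ (mhessian I g x).Nondegenerate ∧ morseIndex I g x = morseIndex I f x := by
  set a : M → ℝ := fun y => c * f y + c' with ha_def
  have ha : IsMorse I a := hf.const_mul_add hc.ne' c'
  have hd : MDifferentiableAt I 𝓘(ℝ, ℝ) f x := hf.contMDiff.mdifferentiableAt (by simp)
  have hxa : IsMCriticalPt I a x := (isMCriticalPt_const_mul_add_iff hc.ne' c' hd).2 hx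
  have h0 : g =ᶠ[𝓝 x] fun y => a y + 0 := h.trans (Eventually.of_forall fun y => (add_zero _).symm)
  have hcrit : IsMCriticalPt I g x := (isMCriticalPt_congr_of_eventuallyEq_add_const h0).2 hxa
  have hmh : mhessian I g x = mhessian I a x := mhessian_congr_of_eventuallyEq_add_const h0
  refine ⟨hcrit, by rw [hmh]; exact ha.nondegenerate hxa, ?_⟩
  have hi : morseIndex I g x = morseIndex I a x := by unfold morseIndex; rw [hmh]
  rw [hi, ha_def]
  exact morseIndex_const_mul_add f hc c' x

/-- **A function which near a critical point `x` of the Morse function `f` equals `c' - c · f`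
with `c > 0`** is critical at `x`, has nondegenerate Hessian there, and COMPLEMENTARY Morse index:
`index_x g + index_x f = dim M` (Milnor 1965, proof of Thm. 9.1: turning about). [cite: MilnorHCobordism1965, proof of Thm. 9.1] -/
theorem morseData_of_eventuallyEq_const_sub_affine {f g : M → ℝ} (hf : IsMorse I f) {x : M}
    {c c' : ℝ} (hc : 0 < c) (h : g =ᶠ[𝓝 x] fun y => c' - c * f y) (hx : IsMCriticalPt I f x) :
    IsMCriticalPt I g x ∧ (mhessian I g x).Nondegenerate ∧
      morseIndex I g x + morseIndex I f x = Module.finrank ℝ E := by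
  set a : M → ℝ := fun y => c * f y + 0 with ha_def
  set b : M → ℝ := fun y => c' - a y with hb_def
  have ha : IsMorse I a := hf.const_mul_add hc.ne' 0
  have hb : IsMorse I b := ha.const_sub c'
  have hd : MDifferentiableAt I 𝓘(ℝ, ℝ) f x := hf.contMDiff.mdifferentiableAt (by simp)
  have hda : MDifferentiableAt I 𝓘(ℝ, ℝ) a x := ha.contMDiff.mdifferentiableAt (by simp)
  have hxa : IsMCriticalPt I a x := (isMCriticalPt_const_mul_add_iff hc.ne' 0 hd).2 hx
  have hxb : IsMCriticalPt I b x := (isMCriticalPt_const_sub_iff c' hda).2 hxa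
  have h0 : g =ᶠ[𝓝 x] fun y => b y + 0 :=
    h.trans (Eventually.of_forall fun y => by simp only [hb_def, ha_def]; ring)
  have hcrit : IsMCriticalPt I g x := (isMCriticalPt_congr_of_eventuallyEq_add_const h0).2 hxb
  have hmh : mhessian I g x = mhessian I b x := mhessian_congr_of_eventuallyEq_add_const h0
  refine ⟨hcrit, by rw [hmh]; exact hb.nondegenerate hxb, ?_⟩
  have hi : morseIndex I g x = morseIndex I b x := by unfold morseIndex; rw [hmh]
  have hsum := ha.morseIndex_const_sub_add c' hxa
  have hia : morseIndex I a x = morseIndex I f x := by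
    rw [ha_def]; exact morseIndex_const_mul_add f hc 0 x
  rw [hi, ← hia]
  exact hsum

end LocalAffine

end Summit.SmoothPoincare4.SmoothPoincare4.Theorems.AcyclicBisectionRigidity.SeamGluing

end
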